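import Literature.Barriers.ValiantsHypothesis.FullRankMultilinearFamily
import Mathlib.Data.List.GetD
import HarnessLib

/-!
# The `O(n³)` syntactically multilinear circuit for the Raz–Yehudayoff polynomial
(Raz–Yehudayoff 2008, §4.1 / Thm. 4.4(2), as counted by Alon–Kumar–Volk 2020, §4.1)

Discharges the named fact `Literature.Barriers.ValiantsHypothesis.RazYehudayoff2008_smCircuit` of
`FullRankMultilinear.lean`: there is a constant `C` (we get `C = 6`) such that for every field `F`
and every `n` the Raz–Yehudayoff polynomial `f = f_{1,2n}`, viewed in `K[X]`, `K = F(W)`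
(`razYehudayoffPolyK F n`), has a fan-in-two syntactically multilinear circuit over `K` in the
variables `X` alone with at most `C (n³ + 1)` gates.

**The printed argument.** [RazYehudayoff2008, §4.1]: "by the definition of `f`, there exists a
syntactically multilinear arithmetic circuit of size `poly(n)` computing `f`" — the defining
recursion `f_{i,j} = (1 + x_i x_j) f_{i+1,j-1} + ∑_ℓ ω_{i,ℓ,j} f_{i,ℓ} f_{ℓ+1,j}` IS a circuit once
every `f_{i,j}` is computed once and shared: `O(n²)` even-length intervals, `O(n)` gates each,
and every product gate multiplies polynomials of disjoint intervals (eq. (4.1) of the source: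
`f_{i,j}` only involves `x_k`, `k ∈ [i, j]`). [AlonKumarVolk2020, §4.1, closing remark] counts it:
"[RY08] constructed a full-rank polynomial `g ∈ F[X, Ω']` that has a syntactically multilinear
circuit of size `O(n³)`", and over `K = F(Ω')` "any rational expression in the variables of `Ω'`
is merely a field constant", so the `ω`'s are coefficients of sum gates.

**Rendering.** We work with the family `RazYehudayoff.ryFc S N c` of
`FullRankMultilinearFamily.lean` (the recursion with arbitrary constant coefficients `c i ℓ j ∈ S`
in place of `ω_{i,ℓ,j}`; the vendored polynomial over `K` is the member `c = ω`,
`toRYField_ryF`). The circuit `RazYehudayoff.ryCircuit S n c` is TABULATED: gate number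
`p = (2n+1)·((2n)(m-1) + i) + o` is the `o`-th gate (`0 ≤ o ≤ 2n`) of the block of the interval
`[i, i+2m)` (`1 ≤ m ≤ n`, `0 ≤ i < 2n`; blocks sticking out of `[0, 2n)` are harmless padding),
and inside a block: `o = 0`: `x_i · x_{i+2m-1}`; `o = 1`: `1 + (that)`; `o = 2`:
`(1 + x_i x_{i+2m-1}) · f_{[i+1, i+2m-1)}`; `o = 2t+1` (`1 ≤ t < m`): `f_{[i, i+2t)} · f_{[i+2t, i+2m)}`;
`o = 2t+2`: previous partial sum `+ c_{i, i+2t-1, i+2m-1} ·` (gate `2t+1`); `o > 2m`: padding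
(`∑ ∅`). The block's output is its gate `2m`; `f_{[i', i'+2t)}` is read from block `(t, i')`
(a lower block number), or is the constant `1` when `t = 0` or `i' ≥ 2n`. Size:
`n · 2n · (2n+1) = 4n³ + 2n² ≤ 6 (n³ + 1)` gates. Correctness is proved gate by gate through two
fold lemmas for tabulated straight-line programs (`gateValues_range_map`: exact values;
`gateVarSets_range_map_inv`: an invariant of the syntactic variable sets, here
"`X_v ⊆` the interval of the block of `v`"), from which syntactic multilinearity of every product
gate follows by disjointness of intervals.

## References
* [RazYehudayoff2008] R. Raz, A. Yehudayoff, *Balancing syntactically multilinear arithmetic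
  circuits*, Comput. Complexity 17 (2008) 515–535, §2 (syntactically multilinear), §4.1
  (definition of `f`, eq. (4.1), "size `poly(n)`"), Thm. 4.4(2).
* [AlonKumarVolk2020] N. Alon, M. Kumar, B. L. Volk, *Unbalancing sets and an almost quadratic
  lower bound for syntactically multilinear arithmetic circuits*, Combinatorica 40 (2020) 149–178
  (arXiv:1708.02037, §4.1, closing remark: "a syntactically multilinear circuit of size `O(n³)`",
  computations over `F(Ω')`).
-/

noncomputable section

namespace Literature.Barriers.ValiantsHypothesis

open MvPolynomial Literature.Computability.AlgebraicComplexity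
open Literature.Computability.AlgebraicComplexity.ArithCircuit

namespace RazYehudayoff

/-! ### Tabulated straight-line programs: two fold lemmas -/

section Folds

variable {k : Type*} {σ : Type*}

variable [CommSemiring k] in
/-- **Values of a tabulated straight-line program.** If gate `p` evaluates to `spec p` whenever
the earlier gates have the values `spec 0, …, spec (p-1)`, then these are the gate values
(induction along the left fold `ArithCircuit.gateValues`). [folklore] -/
theorem gateValues_range_map (gateAt : ℕ → Gate k σ) (spec : ℕ → MvPolynomial σ k) {T : ℕ}
    (h : ∀ p < T, (gateAt p).eval ((List.range p).map spec) = spec p) :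
    gateValues ((List.range T).map gateAt) = (List.range T).map spec := by
  induction T with
  | zero => rfl
  | succ T ih =>
    simp only [List.range_succ, List.map_append, List.map_singleton,
      gateValues_append_singleton]
    rw [ih (fun p hp => h p (by omega)), h T (by omega)]

variable [DecidableEq σ]

/-- One step of the left fold `gateVarSets`. [folklore] -/
theorem gateVarSets_append_singleton (gs : List (Gate k σ)) (g : Gate k σ) :
    gateVarSets (gs ++ [g]) = gateVarSets gs ++ [gateVarSet (gateVarSets gs) g] := by
  simp [gateVarSets, List.foldl_append]

/-- `gateVarSets` has one entry per gate. [folklore] -/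
theorem length_gateVarSets (gs : List (Gate k σ)) : (gateVarSets gs).length = gs.length := by
  induction gs using List.reverseRecOn with
  | nil => rfl
  | append_singleton gs g ih =>
    simp [gateVarSets_append_singleton, ih]

/-- **Invariants of the syntactic variable sets of a tabulated program**: a property of
(gate number, variable set) that holds for `∅` and is preserved by every gate holds for every
entry of `gateVarSets` (and trivially out of range). [folklore] -/
theorem gateVarSets_range_map_inv (gateAt : ℕ → Gate k σ) (I : ℕ → Finset σ → Prop)
    (h0 : ∀ q, I q ∅) {T : ℕ}
    (h : ∀ p < T, ∀ vs : List (Finset σ), vs.length = p → (∀ q, I q (vs.getD q ∅)) →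
      I p (gateVarSet vs (gateAt p))) :
    ∀ q, I q ((gateVarSets ((List.range T).map gateAt)).getD q ∅) := by
  induction T with
  | zero =>
    intro q
    simpa [gateVarSets] using h0 q
  | succ T ih =>
    have ih' := ih (fun p hp => h p (by omega))
    have hlen : (gateVarSets ((List.range T).map gateAt)).length = T := by
      rw [length_gateVarSets, List.length_map, List.length_range]
    intro q
    simp only [List.range_succ, List.map_append, List.map_singleton,
      gateVarSets_append_singleton]
    by_cases hq : q < T
    · rw [List.getD_append _ _ _ _ (by rw [hlen]; exact hq)]
      exact ih' q
    · rw [List.getD_append_right _ _ _ _ (by rw [hlen]; omega), hlen]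
      obtain hqT | hqT := eq_or_lt_of_le (not_lt.mp hq)
      · subst hqT
        rw [Nat.sub_self, List.getD_cons_zero]
        exact h _ (by omega) _ hlen ih'
      · obtain ⟨d, hd⟩ : ∃ d, q - T = d + 1 := ⟨q - T - 1, by omega⟩
        rw [hd, List.getD_cons_succ, List.getD_nil]
        exact h0 q

end Folds

/-! ### Out-of-range intervals -/

section OutOfRange

variable {S : Type*} [CommSemiring S] {N : ℕ}

/-- If the coefficients `c i ℓ j` vanish for `i ≥ N` (as the `ω_{i,ℓ,j}` do), then
`f_{[i, i+len)} = 1` for every `i ≥ N` (all its variables and coefficients vanish). [folklore] -/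
theorem ryFc_eq_one_of_le (c : ℕ → ℕ → ℕ → S) (hc : ∀ i l j, N ≤ i → c i l j = 0)
    (fuel : ℕ) {len i : ℕ} (hi : N ≤ i) : ryFc S N c fuel len i = 1 := by
  induction fuel generalizing len i with
  | zero => simp [ryFc]
  | succ fuel ih =>
    by_cases hlen : len = 0
    · subst hlen
      simp
    · rw [ryFc_succ c hlen, ih (by omega : N ≤ i + 1)]
      have hx : xv S N i = 0 := by
        unfold xv
        rw [dif_neg (by omega)]
      rw [hx, zero_mul, add_zero, one_mul, Finset.sum_eq_zero, add_zero]
      intro a _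
      rw [hc _ _ _ hi, C_0, zero_mul, zero_mul]

end OutOfRange

/-! ### The tabulated circuit -/

section Circuit

variable (S : Type*) [CommSemiring S] (n : ℕ) (c : ℕ → ℕ → ℕ → S)

/-- Block number of the interval block `(m, i)`, i.e. of `[i, i + 2m)` (`1 ≤ m ≤ n`,
`0 ≤ i < 2n`). [folklore] -/
def blk (m i : ℕ) : ℕ := 2 * n * (m - 1) + i

/-- Gate number of the `o`-th gate (`0 ≤ o ≤ 2n`) of block `(m, i)`. [folklore] -/
def enc (m i o : ℕ) : ℕ := (2 * n + 1) * blk n m i + o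

/-- Offset in its block of gate number `p`. [folklore] -/
def dO (p : ℕ) : ℕ := p % (2 * n + 1)

/-- Left end point `i` of the block of gate number `p`. [folklore] -/
def dI (p : ℕ) : ℕ := p / (2 * n + 1) % (2 * n)

/-- Half-length `m` of the block of gate number `p`. [folklore] -/
def dM (p : ℕ) : ℕ := p / (2 * n + 1) / (2 * n) + 1

variable {n} in
/-- Decoding an encoded gate number. [folklore] -/
theorem dec_enc {m i o : ℕ} (m1 : 1 ≤ m) (hi : i < 2 * n) (ho : o ≤ 2 * n) :
    dM n (enc n m i o) = m ∧ dI n (enc n m i o) = i ∧ dO n (enc n m i o) = o := by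
  have hB : 0 < 2 * n + 1 := by omega
  have hN : 0 < 2 * n := by omega
  have hq : enc n m i o / (2 * n + 1) = blk n m i := by
    unfold enc
    rw [Nat.mul_add_div hB, Nat.div_eq_of_lt (by omega), add_zero]
  refine ⟨?_, ?_, ?_⟩
  · unfold dM
    rw [hq]
    unfold blk
    rw [Nat.mul_add_div hN, Nat.div_eq_of_lt hi, add_zero]
    omega
  · unfold dI
    rw [hq]
    unfold blk
    rw [Nat.mul_add_mod, Nat.mod_eq_of_lt hi]
  · unfold dO enc
    rw [Nat.mul_add_mod, Nat.mod_eq_of_lt (by omega)]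

variable {n} in
/-- Every gate number below the size decodes to a valid triple, and re-encodes to itself. [folklore] -/
theorem dec_valid {p : ℕ} (hp : p < n * (2 * n) * (2 * n + 1)) :
    1 ≤ dM n p ∧ dM n p ≤ n ∧ dI n p < 2 * n ∧ dO n p ≤ 2 * n ∧
      enc n (dM n p) (dI n p) (dO n p) = p := by
  have hB : 0 < 2 * n + 1 := by omega
  have hn : 0 < n := by
    rcases Nat.eq_zero_or_pos n with h | h
    · subst h
      simp at hp
    · exact h
  have hN : 0 < 2 * n := by omega
  have hq : p / (2 * n + 1) < n * (2 * n) := (Nat.div_lt_iff_lt_mul hB).2 hp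
  refine ⟨Nat.le_add_left 1 _, ?_, ?_, ?_, ?_⟩
  · unfold dM
    exact (Nat.div_lt_iff_lt_mul hN).2 hq
  · unfold dI
    exact Nat.mod_lt _ hN
  · unfold dO
    have := Nat.mod_lt p hB
    omega
  · unfold enc blk dM dI dO
    rw [Nat.add_sub_cancel, Nat.div_add_mod (p / (2 * n + 1)) (2 * n), Nat.div_add_mod p (2 * n + 1)]

variable {n} in
/-- Gates of lower blocks have smaller numbers. [folklore] -/
theorem enc_lt_enc {t i' o' m i o : ℕ} (t1 : 1 ≤ t) (htm : t < m) (hi' : i' < 2 * n)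
    (ho' : o' ≤ 2 * n) : enc n t i' o' < enc n m i o := by
  unfold enc blk
  have h0 : 2 * n * (t - 1) + 2 * n = 2 * n * t := by
    rw [← Nat.mul_succ, Nat.succ_eq_add_one, Nat.sub_add_cancel t1]
  have h2 : 2 * n * t ≤ 2 * n * (m - 1) := Nat.mul_le_mul_left _ (by omega)
  have h1 : 2 * n * (t - 1) + i' + 1 ≤ 2 * n * (m - 1) + i := by omega
  calc (2 * n + 1) * (2 * n * (t - 1) + i') + o'
      < (2 * n + 1) * (2 * n * (t - 1) + i') + (2 * n + 1) := by omega
    _ = (2 * n + 1) * (2 * n * (t - 1) + i' + 1) := by ring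
    _ ≤ (2 * n + 1) * (2 * n * (m - 1) + i) := Nat.mul_le_mul_left _ h1
    _ ≤ (2 * n + 1) * (2 * n * (m - 1) + i) + o := Nat.le_add_right _ _

variable {n} in
/-- Inside a block the gate number grows with the offset. [folklore] -/
theorem enc_lt_enc_same {m i o o' : ℕ} (h : o' < o) : enc n m i o' < enc n m i o := by
  unfold enc
  omega

/-- The shape of an offset: one of `0`, `1`, `2`, padding `> 2m`, odd `2t+1` with `1 ≤ t < m`,
or even `2s+4` with `s + 2 ≤ m`. [folklore] -/
theorem o_cases (m o : ℕ) : o = 0 ∨ o = 1 ∨ o = 2 ∨ 2 * m < o ∨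
    (∃ t, 1 ≤ t ∧ t < m ∧ o = 2 * t + 1) ∨ (∃ s, s + 2 ≤ m ∧ o = 2 * s + 4) := by
  obtain ⟨k, rfl | rfl⟩ := Nat.even_or_odd' o
  · rcases Nat.lt_or_ge (2 * m) (2 * k) with h | h
    · exact Or.inr (Or.inr (Or.inr (Or.inl h)))
    · rcases k with _ | _ | s
      · exact Or.inl rfl
      · exact Or.inr (Or.inr (Or.inl rfl))
      · exact Or.inr (Or.inr (Or.inr (Or.inr (Or.inr ⟨s, by omega, by ring⟩))))
  · rcases Nat.lt_or_ge (2 * m) (2 * k + 1) with h | h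
    · exact Or.inr (Or.inr (Or.inr (Or.inl h)))
    · rcases k with _ | t
      · exact Or.inr (Or.inl rfl)
      · exact Or.inr (Or.inr (Or.inr (Or.inr (Or.inl ⟨t + 1, by omega, by omega, by ring⟩))))

/-- The input `x_i` as an operand (the constant `0` out of range, as `xv`). [cite: RazYehudayoff2008, §4.1] -/
def xOp (i : ℕ) : Operand S (Fin (2 * n)) :=
  if h : i < 2 * n then .var ⟨i, h⟩ else .const 0

/-- The operand carrying `f_{[i, i+2t)}`: the output gate (offset `2t`) of block `(t, i)`, or
the constant `1` for the empty interval (`t = 0`) and for `i` out of range. [cite: RazYehudayoff2008, §4.1] -/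
def refOp (t i : ℕ) : Operand S (Fin (2 * n)) :=
  if t = 0 ∨ 2 * n ≤ i then .const 1 else .gate (enc n t i (2 * t))

/-- **The gates of the block of `[i, i+2m)`** (printed recursion of [RazYehudayoff2008, §4.1],
`j = i + 2m - 1`): `o = 0`: `x_i x_j`; `o = 1`: `1 + x_i x_j`; `o = 2`: `(1 + x_i x_j) f_{i+1,j-1}`;
`o = 2t+1`, `1 ≤ t < m`: `f_{[i,i+2t)} f_{[i+2t, j]}`; `o = 2t+2`: partial sum up to `ℓ = i+2t-1`
(the `ω` as the coefficient of a fan-in-two sum gate); `o > 2m`: padding `∑ ∅ = 0`.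
[cite: RazYehudayoff2008, §4.1] -/
def blockGate (m i o : ℕ) : Gate S (Fin (2 * n)) :=
  if o = 0 then .prod [xOp S n i, xOp S n (i + 2 * m - 1)]
  else if o = 1 then .sum [(1, .const 1), (1, .gate (enc n m i 0))]
  else if o = 2 then .prod [.gate (enc n m i 1), refOp S n (m - 1) (i + 1)]
  else if 2 * m < o then .sum []
  else if o % 2 = 1 then .prod [refOp S n (o / 2) i, refOp S n (m - o / 2) (i + 2 * (o / 2))]
  else .sum [(1, .gate (enc n m i (o - 2))),
    (c i (i + o - 3) (i + 2 * m - 1), .gate (enc n m i (o - 1)))]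

/-- Gate number `p` of the circuit. [cite: RazYehudayoff2008, §4.1] -/
def gateAt (p : ℕ) : Gate S (Fin (2 * n)) :=
  blockGate S n c (dM n p) (dI n p) (dO n p)

/-- **The syntactically multilinear circuit for `f = f_{1,2n}`**: `n · 2n · (2n+1)` tabulated
gates, output = the output gate of the block of `[0, 2n)`. [cite: RazYehudayoff2008, §4.1 and Thm. 4.4(2)] [cite: AlonKumarVolk2020, §4.1 (size `O(n³)`)] -/
def ryCircuit : ArithCircuit S (Fin (2 * n)) where
  gates := (List.range (n * (2 * n) * (2 * n + 1))).map (gateAt S n c)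
  output := refOp S n n 0

/-- The size of the circuit: `n · 2n · (2n+1)` gates. [cite: AlonKumarVolk2020, §4.1] -/
theorem size_ryCircuit : (ryCircuit S n c).size = n * (2 * n) * (2 * n + 1) := by
  simp [ryCircuit, ArithCircuit.size]

/-- `n · 2n · (2n+1) ≤ 6 (n³ + 1)`. [folklore] -/
theorem size_ryCircuit_le : (ryCircuit S n c).size ≤ 6 * (n ^ 3 + 1) := by
  rw [size_ryCircuit]
  have e : n * (2 * n) * (2 * n + 1) = 4 * n ^ 3 + 2 * n ^ 2 := by ring
  rcases Nat.eq_zero_or_pos n with h | h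
  · subst h
    simp
  · have : n ^ 2 ≤ n ^ 3 := Nat.pow_le_pow_right h (by norm_num)
    omega

/-- Every gate has fan-in at most two. [cite: RazYehudayoff2008, §2] -/
theorem isFanInTwo_ryCircuit : (ryCircuit S n c).IsFanInTwo := by
  intro g hg
  simp only [ryCircuit, List.mem_map, List.mem_range] at hg
  obtain ⟨p, -, rfl⟩ := hg
  unfold gateAt blockGate
  split_ifs <;> simp [Gate.fanIn, Gate.args]

/-! ### Equations of the block gates -/

/-- Offset `0`. [folklore] -/
theorem blockGate_zero (m i : ℕ) :
    blockGate S n c m i 0 = .prod [xOp S n i, xOp S n (i + 2 * m - 1)] := by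
  simp [blockGate]

/-- Offset `1`. [folklore] -/
theorem blockGate_one (m i : ℕ) :
    blockGate S n c m i 1 = .sum [(1, .const 1), (1, .gate (enc n m i 0))] := by
  simp [blockGate]

/-- Offset `2`. [folklore] -/
theorem blockGate_two (m i : ℕ) :
    blockGate S n c m i 2 = .prod [.gate (enc n m i 1), refOp S n (m - 1) (i + 1)] := by
  simp [blockGate]

/-- Padding offsets. [folklore] -/
theorem blockGate_big {m i o : ℕ} (m1 : 1 ≤ m) (h : 2 * m < o) :
    blockGate S n c m i o = .sum [] := by
  unfold blockGate
  rw [if_neg (by omega), if_neg (by omega), if_neg (by omega), if_pos h]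

/-- Odd offsets `2t+1`, `1 ≤ t < m`: the product gates of the sum. [folklore] -/
theorem blockGate_odd {m i t : ℕ} (t1 : 1 ≤ t) (ht : t < m) :
    blockGate S n c m i (2 * t + 1) = .prod [refOp S n t i, refOp S n (m - t) (i + 2 * t)] := by
  unfold blockGate
  rw [if_neg (by omega), if_neg (by omega), if_neg (by omega), if_neg (by omega),
    if_pos (by omega), show (2 * t + 1) / 2 = t by omega]

/-- Even offsets `2s+4`, `s + 2 ≤ m`: the partial sums. [folklore] -/
theorem blockGate_even {m i s : ℕ} (hs : s + 2 ≤ m) :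
    blockGate S n c m i (2 * s + 4) = .sum [(1, .gate (enc n m i (2 * s + 2))),
      (c i (i + 2 * s + 1) (i + 2 * m - 1), .gate (enc n m i (2 * s + 3)))] := by
  unfold blockGate
  rw [if_neg (by omega), if_neg (by omega), if_neg (by omega), if_neg (by omega),
    if_neg (by omega), show 2 * s + 4 - 2 = 2 * s + 2 by omega,
    show 2 * s + 4 - 1 = 2 * s + 3 by omega, show i + (2 * s + 4) - 3 = i + 2 * s + 1 by omega]

/-! ### The intended values -/

/-- `f_{[i, i+len)}` (fuel `n`, enough for `len ≤ 2n`). [cite: RazYehudayoff2008, §4.1] -/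
def gv (len i : ℕ) : MvPolynomial (Fin (2 * n)) S :=
  ryFc S (2 * n) c n len i

/-- The head term `(1 + x_i x_{i+2m-1}) f_{[i+1, i+2m-1)}` of the recursion. [cite: RazYehudayoff2008, §4.1] -/
def hd (m i : ℕ) : MvPolynomial (Fin (2 * n)) S :=
  (1 + xv S (2 * n) i * xv S (2 * n) (i + 2 * m - 1)) * gv S n c (2 * (m - 1)) (i + 1)

/-- The summand `c_{i, ℓ, j} f_{[i, ℓ]} f_{[ℓ+1, j]}`, `ℓ = i + 2s + 1`, of the recursion. [cite: RazYehudayoff2008, §4.1] -/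
def term (m i s : ℕ) : MvPolynomial (Fin (2 * n)) S :=
  C (c i (i + 2 * s + 1) (i + 2 * m - 1)) *
    (gv S n c (2 * (s + 1)) i * gv S n c (2 * (m - (s + 1))) (i + 2 * (s + 1)))

/-- The partial sums of the recursion (head term plus the first `t` summands). [cite: RazYehudayoff2008, §4.1] -/
def partialSum (m i t : ℕ) : MvPolynomial (Fin (2 * n)) S :=
  hd S n c m i + ∑ s ∈ Finset.range t, term S n c m i s

/-- The intended value of the `o`-th gate of block `(m, i)`. [cite: RazYehudayoff2008, §4.1] -/
def spec (m i o : ℕ) : MvPolynomial (Fin (2 * n)) S :=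
  if o = 0 then xv S (2 * n) i * xv S (2 * n) (i + 2 * m - 1)
  else if o = 1 then 1 + xv S (2 * n) i * xv S (2 * n) (i + 2 * m - 1)
  else if 2 * m < o then 0
  else if o % 2 = 1 then
    gv S n c (2 * (o / 2)) i * gv S n c (2 * (m - o / 2)) (i + 2 * (o / 2))
  else partialSum S n c m i (o / 2 - 1)

/-- The intended value of gate number `p`. [cite: RazYehudayoff2008, §4.1] -/
def specAt (p : ℕ) : MvPolynomial (Fin (2 * n)) S :=
  spec S n c (dM n p) (dI n p) (dO n p)

/-- Reading an intended value from the tabulated list of intended values. [folklore] -/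
theorem getD_map_specAt {K q : ℕ} (hq : q < K) :
    ((List.range K).map (specAt S n c)).getD q 0 = specAt S n c q := by
  rw [List.getD_eq_getElem _ _ (by simpa using hq), List.getElem_map, List.getElem_range]

/-- **The recursion, unrolled**: `f_{[i, i+2m)}` is the last partial sum (`1 ≤ m ≤ n`; fuel
bookkeeping by `ryFc_stable`, reindexing `a = 2(s+1)`). [cite: RazYehudayoff2008, §4.1] -/
theorem gv_two_mul {m : ℕ} (m1 : 1 ≤ m) (mn : m ≤ n) (i : ℕ) :
    gv S n c (2 * m) i = partialSum S n c m i (m - 1) := by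
  have hn : n - 1 + 1 = n := Nat.sub_add_cancel (m1.trans mn)
  unfold partialSum hd term gv
  rw [show ryFc S (2 * n) c n (2 * m) i = ryFc S (2 * n) c (n - 1 + 1) (2 * m) i by rw [hn],
    ryFc_succ c (by omega : 2 * m ≠ 0) (n - 1) i]
  congr 1
  · rw [ryFc_stable c (fuel := n - 1) (fuel' := n) (len := 2 * m - 2) (by omega) (by omega),
      show 2 * m - 2 = 2 * (m - 1) by omega]
  · have hset : (Finset.range (2 * m - 1)).filter (fun a => Even a ∧ 2 ≤ a) =
        (Finset.range (m - 1)).map ⟨fun s => 2 * (s + 1), by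
          intro a b hab
          have h' : 2 * (a + 1) = 2 * (b + 1) := hab
          omega⟩ := by
      ext a
      simp only [Finset.mem_filter, Finset.mem_range, Finset.mem_map,
        Function.Embedding.coeFn_mk]
      constructor
      · rintro ⟨h1, ⟨r, hr⟩, h2⟩
        exact ⟨r - 1, by omega, by omega⟩
      · rintro ⟨s, hs, rfl⟩
        exact ⟨by omega, ⟨s + 1, by ring⟩, by omega⟩
    rw [hset, Finset.sum_map]
    refine Finset.sum_congr rfl fun s hs => ?_
    simp only [Finset.mem_range] at hs
    simp only [Function.Embedding.coeFn_mk]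
    rw [ryFc_stable c (fuel := n - 1) (fuel' := n) (len := 2 * (s + 1)) (by omega) (by omega),
      ryFc_stable c (fuel := n - 1) (fuel' := n) (len := 2 * m - 2 * (s + 1)) (by omega)
        (by omega),
      show i + 2 * (s + 1) - 1 = i + 2 * s + 1 by omega,
      show 2 * m - 2 * (s + 1) = 2 * (m - (s + 1)) by omega, mul_assoc]

/-- Offset `0`. [folklore] -/
theorem spec_zero (m i : ℕ) :
    spec S n c m i 0 = xv S (2 * n) i * xv S (2 * n) (i + 2 * m - 1) := by
  simp [spec]

/-- Offset `1`. [folklore] -/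
theorem spec_one (m i : ℕ) :
    spec S n c m i 1 = 1 + xv S (2 * n) i * xv S (2 * n) (i + 2 * m - 1) := by
  simp [spec]

/-- Padding offsets. [folklore] -/
theorem spec_big {m i o : ℕ} (m1 : 1 ≤ m) (h : 2 * m < o) : spec S n c m i o = 0 := by
  unfold spec
  rw [if_neg (by omega), if_neg (by omega), if_pos h]

/-- Odd offsets. [folklore] -/
theorem spec_odd {m i t : ℕ} (t1 : 1 ≤ t) (ht : t < m) :
    spec S n c m i (2 * t + 1) = gv S n c (2 * t) i * gv S n c (2 * (m - t)) (i + 2 * t) := by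
  unfold spec
  rw [if_neg (by omega), if_neg (by omega), if_neg (by omega), if_pos (by omega),
    show (2 * t + 1) / 2 = t by omega]

/-- Even offsets `≥ 2`. [folklore] -/
theorem spec_even {m i s : ℕ} (hs : s + 1 ≤ m) :
    spec S n c m i (2 * s + 2) = partialSum S n c m i s := by
  unfold spec
  rw [if_neg (by omega), if_neg (by omega), if_neg (by omega), if_neg (by omega),
    show (2 * s + 2) / 2 - 1 = s by omega]

/-- Offset `2`: the head term. [folklore] -/
theorem spec_two {m i : ℕ} (m1 : 1 ≤ m) : spec S n c m i 2 = hd S n c m i := by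
  have h := spec_even S n c (m := m) (i := i) (s := 0) m1
  rw [show 2 * 0 + 2 = 2 by rfl] at h
  rw [h]
  simp [partialSum]

/-- **The output gate of a block carries `f_{[i, i+2m)}`.** [cite: RazYehudayoff2008, §4.1] -/
theorem spec_top {m i : ℕ} (m1 : 1 ≤ m) (mn : m ≤ n) :
    spec S n c m i (2 * m) = gv S n c (2 * m) i := by
  have h := spec_even S n c (m := m) (i := i) (s := m - 1) (by omega)
  rw [show 2 * (m - 1) + 2 = 2 * m by omega] at h
  rw [h, gv_two_mul S n c m1 mn]

/-! ### Gate values -/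

/-- The operand `x_i` evaluates to `xv i`. [folklore] -/
theorem eval_xOp (vals : List (MvPolynomial (Fin (2 * n)) S)) (i : ℕ) :
    (xOp S n i).eval vals = xv S (2 * n) i := by
  unfold xOp xv
  split_ifs with h <;> simp [Operand.eval]

variable {n c} in
/-- The operand `refOp t i` evaluates to `f_{[i, i+2t)}` once the output gate of block `(t, i)`
does (the constant `1` covers `t = 0` and `i ≥ 2n`). [cite: RazYehudayoff2008, §4.1] -/
theorem eval_refOp (hc : ∀ i l j, 2 * n ≤ i → c i l j = 0)
    (vals : List (MvPolynomial (Fin (2 * n)) S)) {t i : ℕ}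
    (h : t ≠ 0 → i < 2 * n → vals.getD (enc n t i (2 * t)) 0 = gv S n c (2 * t) i) :
    (refOp S n t i).eval vals = gv S n c (2 * t) i := by
  unfold refOp
  split_ifs with h'
  · simp only [Operand.eval, C_1]
    rcases h' with rfl | hi
    · simp [gv]
    · exact (ryFc_eq_one_of_le c hc n hi).symm
  · rw [not_or, not_le] at h'
    simpa [Operand.eval] using h h'.1 h'.2

variable {n c} in
/-- **Every block gate computes its intended value** from the intended values of the gates
below it. [cite: RazYehudayoff2008, §4.1] -/
theorem eval_blockGate (hc : ∀ i l j, 2 * n ≤ i → c i l j = 0) {m i o : ℕ} (m1 : 1 ≤ m)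
    (mn : m ≤ n) (hi : i < 2 * n) (_ho : o ≤ 2 * n)
    (vals : List (MvPolynomial (Fin (2 * n)) S))
    (hv : ∀ m' i' o', 1 ≤ m' → m' ≤ n → i' < 2 * n → o' ≤ 2 * n →
      enc n m' i' o' < enc n m i o → vals.getD (enc n m' i' o') 0 = spec S n c m' i' o') :
    (blockGate S n c m i o).eval vals = spec S n c m i o := by
  -- the output gates of lower blocks
  have href : ∀ t i', t < m → (t ≠ 0 → i' < 2 * n →
      vals.getD (enc n t i' (2 * t)) 0 = gv S n c (2 * t) i') := by
    intro t i' htm ht0 hi'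
    rw [hv t i' (2 * t) (by omega) (by omega) hi' (by omega)
      (enc_lt_enc (by omega) htm hi' (by omega)), spec_top S n c (by omega) (by omega)]
  rcases o_cases m o with rfl | rfl | rfl | hbig | ⟨t, t1, htm, rfl⟩ | ⟨s, hs, rfl⟩
  · -- `x_i x_j`
    rw [blockGate_zero, spec_zero]
    simp [Gate.eval, eval_xOp]
  · -- `1 + x_i x_j`
    rw [blockGate_one, spec_one]
    have h0 := hv m i 0 m1 mn hi (by omega) (enc_lt_enc_same (by omega))
    rw [spec_zero] at h0
    simp only [Gate.eval, List.map_cons, List.map_nil, List.sum_cons, List.sum_nil, add_zero,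
      Operand.eval, one_smul, h0, C_1]
  · -- `(1 + x_i x_j) f_{i+1, j-1}`
    rw [blockGate_two, spec_two S n c m1]
    have h1 := hv m i 1 m1 mn hi (by omega) (enc_lt_enc_same (by omega))
    rw [spec_one] at h1
    simp only [Gate.eval, List.map_cons, List.map_nil, List.prod_cons, List.prod_nil, mul_one,
      Operand.eval_gate, h1, eval_refOp S hc vals (href (m - 1) (i + 1) (by omega))]
    rfl
  · -- padding
    rw [blockGate_big S n c m1 hbig, spec_big S n c m1 hbig]
    simp [Gate.eval]
  · -- `f_{[i, i+2t)} f_{[i+2t, j]}`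
    rw [blockGate_odd S n c t1 htm, spec_odd S n c t1 htm]
    simp only [Gate.eval, List.map_cons, List.map_nil, List.prod_cons, List.prod_nil, mul_one]
    rw [eval_refOp S hc vals (href t i htm),
      eval_refOp S hc vals (t := m - t) (i := i + 2 * t) (href (m - t) (i + 2 * t) (by omega))]
  · -- partial sums
    rw [blockGate_even S n c hs]
    have e1 := hv m i (2 * s + 2) m1 mn hi (by omega) (enc_lt_enc_same (by omega))
    have e2 := hv m i (2 * s + 3) m1 mn hi (by omega) (enc_lt_enc_same (by omega))
    rw [spec_even S n c (by omega)] at e1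
    have e2' : spec S n c m i (2 * s + 3) =
        gv S n c (2 * (s + 1)) i * gv S n c (2 * (m - (s + 1))) (i + 2 * (s + 1)) := by
      rw [show 2 * s + 3 = 2 * (s + 1) + 1 by ring]
      exact spec_odd S n c (by omega) (by omega)
    rw [e2'] at e2
    have e3 : spec S n c m i (2 * s + 4) = partialSum S n c m i (s + 1) := by
      rw [show 2 * s + 4 = 2 * (s + 1) + 2 by ring]
      exact spec_even S n c (by omega)
    rw [e3]
    simp only [Gate.eval, List.map_cons, List.map_nil, List.sum_cons, List.sum_nil, add_zero,
      Operand.eval_gate, one_smul, e1, e2]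
    rw [partialSum, partialSum, Finset.sum_range_succ, smul_eq_C_mul, add_assoc]
    rfl

variable {n c} in
/-- **The gate values of the circuit are the intended values.** [cite: RazYehudayoff2008, §4.1] -/
theorem gateValues_ryCircuit (hc : ∀ i l j, 2 * n ≤ i → c i l j = 0) :
    gateValues (ryCircuit S n c).gates =
      (List.range (n * (2 * n) * (2 * n + 1))).map (specAt S n c) := by
  apply gateValues_range_map
  intro p hp
  obtain ⟨m1, mn, hi, ho, hp'⟩ := dec_valid hp
  show (blockGate S n c (dM n p) (dI n p) (dO n p)).eval _ = spec S n c (dM n p) (dI n p) (dO n p)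
  refine eval_blockGate S hc m1 mn hi ho _ fun m' i' o' h1 _ h3 h4 hlt => ?_
  rw [hp'] at hlt
  rw [getD_map_specAt S n c hlt]
  show spec S n c (dM n (enc n m' i' o')) (dI n (enc n m' i' o')) (dO n (enc n m' i' o')) = _
  obtain ⟨e1, e2, e3⟩ := dec_enc h1 h3 h4
  rw [e1, e2, e3]

variable {n c} in
/-- **The circuit computes `f_{[0, 2n)}`.** [cite: RazYehudayoff2008, §4.1 and Thm. 4.4(2)] -/
theorem eval_ryCircuit (hc : ∀ i l j, 2 * n ≤ i → c i l j = 0) :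
    (ryCircuit S n c).eval = gv S n c (2 * n) 0 := by
  show (refOp S n n 0).eval (gateValues (ryCircuit S n c).gates) = _
  rw [gateValues_ryCircuit S hc]
  refine eval_refOp S hc _ fun hn0 h0 => ?_
  have hlt : enc n n 0 (2 * n) < n * (2 * n) * (2 * n + 1) := by
    have h := enc_lt_enc (n := n) (t := n) (m := n + 1) (i' := 0) (o' := 2 * n) (i := 0) (o := 0)
      (by omega) (by omega) h0 le_rfl
    have he : enc n (n + 1) 0 0 = n * (2 * n) * (2 * n + 1) := by
      simp only [enc, blk, Nat.add_sub_cancel]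
      ring
    omega
  rw [getD_map_specAt S n c hlt]
  show spec S n c (dM n (enc n n 0 (2 * n))) (dI n (enc n n 0 (2 * n)))
    (dO n (enc n n 0 (2 * n))) = _
  obtain ⟨e1, e2, e3⟩ := dec_enc (n := n) (m := n) (i := 0) (o := 2 * n) (by omega) h0 le_rfl
  rw [e1, e2, e3, spec_top S n c (by omega) le_rfl]

/-! ### Syntactic variable sets: every gate of block `(m, i)` only involves `x_k`, `k ∈ [i, i+2m)` -/

/-- The bound on the syntactic variable set of the `o`-th gate of block `(m, i)`: the two end
points for `o ≤ 1`, the whole interval otherwise. [cite: RazYehudayoff2008, §4.1 (eq. (4.1))] -/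
def vbound (m i o : ℕ) : Finset (Fin (2 * n)) :=
  if o ≤ 1 then Iv (2 * n) i 1 ∪ Iv (2 * n) (i + 2 * m - 1) 1 else Iv (2 * n) i (2 * m)

variable {n} in
/-- The bound lies inside the interval of the block. [folklore] -/
theorem vbound_subset {m i : ℕ} (m1 : 1 ≤ m) (o : ℕ) : vbound n m i o ⊆ Iv (2 * n) i (2 * m) := by
  unfold vbound
  split_ifs
  · exact Finset.union_subset (Iv_subset le_rfl (by omega)) (Iv_subset (by omega) (by omega))
  · exact subset_rfl

/-- The operand `x_i` involves only position `i`. [folklore] -/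
theorem operandVarSet_xOp (vs : List (Finset (Fin (2 * n)))) (i : ℕ) :
    operandVarSet vs (xOp S n i) ⊆ Iv (2 * n) i 1 := by
  unfold xOp
  split_ifs with h
  · intro k hk
    simp only [operandVarSet, Finset.mem_singleton] at hk
    subst hk
    simp
  · simp [operandVarSet]

/-- The operand `refOp t i` involves only positions in `[i, i+2t)`, given the bound for the
output gate of block `(t, i)`. [cite: RazYehudayoff2008, §4.1 (eq. (4.1))] -/
theorem operandVarSet_refOp (vs : List (Finset (Fin (2 * n)))) {t i : ℕ} (ht : t ≤ n)
    (hv : ∀ m' i' o', 1 ≤ m' → m' ≤ n → i' < 2 * n → o' ≤ 2 * n →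
      vs.getD (enc n m' i' o') ∅ ⊆ vbound n m' i' o') :
    operandVarSet vs (refOp S n t i) ⊆ Iv (2 * n) i (2 * t) := by
  unfold refOp
  split_ifs with h
  · simp [operandVarSet]
  · rw [not_or, not_le] at h
    have := hv t i (2 * t) (by omega) ht h.2 (by omega)
    rw [vbound, if_neg (by omega)] at this
    simpa [operandVarSet] using this

/-- **Every block gate respects the bound**, given the bounds for all (valid) gate numbers. [cite: RazYehudayoff2008, §4.1 (eq. (4.1))] -/
theorem varSet_blockGate {m i o : ℕ} (m1 : 1 ≤ m) (mn : m ≤ n) (_hi : i < 2 * n)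
    (_ho : o ≤ 2 * n) (vs : List (Finset (Fin (2 * n))))
    (hv : ∀ m' i' o', 1 ≤ m' → m' ≤ n → i' < 2 * n → o' ≤ 2 * n →
      vs.getD (enc n m' i' o') ∅ ⊆ vbound n m' i' o') :
    gateVarSet vs (blockGate S n c m i o) ⊆ vbound n m i o := by
  rcases o_cases m o with rfl | rfl | rfl | hbig | ⟨t, t1, htm, rfl⟩ | ⟨s, hs, rfl⟩
  · rw [blockGate_zero]
    simp only [gateVarSet, Gate.args, List.map_cons, List.map_nil, List.foldr_cons,
      List.foldr_nil, Finset.union_empty, vbound, if_pos (Nat.zero_le 1)]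
    exact Finset.union_subset_union (operandVarSet_xOp S n vs i) (operandVarSet_xOp S n vs _)
  · rw [blockGate_one]
    have h0 := hv m i 0 m1 mn _hi (by omega)
    simp only [gateVarSet, Gate.args, List.map_cons, List.map_nil, List.foldr_cons,
      List.foldr_nil, Finset.union_empty, operandVarSet, Finset.empty_union]
    rw [vbound, if_pos (Nat.zero_le 1)] at h0
    rw [vbound, if_pos le_rfl]
    exact h0
  · rw [blockGate_two]
    have h1 := (hv m i 1 m1 mn _hi (by omega)).trans (vbound_subset m1 1)
    have h2 := operandVarSet_refOp S n vs (t := m - 1) (i := i + 1) (by omega) hv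
    simp only [gateVarSet, Gate.args, List.map_cons, List.map_nil, List.foldr_cons,
      List.foldr_nil, Finset.union_empty, vbound, if_neg (show ¬ (2 ≤ 1) by omega)]
    refine Finset.union_subset ?_ (h2.trans (Iv_subset (by omega) (by omega)))
    simpa [operandVarSet] using h1
  · rw [blockGate_big S n c m1 hbig]
    simp [gateVarSet, Gate.args]
  · rw [blockGate_odd S n c t1 htm]
    have h1 := operandVarSet_refOp S n vs (t := t) (i := i) (by omega) hv
    have h2 := operandVarSet_refOp S n vs (t := m - t) (i := i + 2 * t) (by omega) hv
    simp only [gateVarSet, Gate.args, List.map_cons, List.map_nil, List.foldr_cons,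
      List.foldr_nil, Finset.union_empty, vbound, if_neg (show ¬ (2 * t + 1 ≤ 1) by omega)]
    exact Finset.union_subset (h1.trans (Iv_subset le_rfl (by omega)))
      (h2.trans (Iv_subset (by omega) (by omega)))
  · rw [blockGate_even S n c hs]
    have h1 := (hv m i (2 * s + 2) m1 mn _hi (by omega)).trans (vbound_subset m1 _)
    have h2 := (hv m i (2 * s + 3) m1 mn _hi (by omega)).trans (vbound_subset m1 _)
    simp only [gateVarSet, Gate.args, List.map_cons, List.map_nil, List.foldr_cons,
      List.foldr_nil, Finset.union_empty, vbound, if_neg (show ¬ (2 * s + 4 ≤ 1) by omega),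
      operandVarSet]
    exact Finset.union_subset h1 h2

/-- **Every product gate multiplies disjoint sets of variables** ("`X_{v₁} ∩ X_{v₂} = ∅`"),
given the bounds for all gate numbers. [cite: RazYehudayoff2008, §2 and §4.1] -/
theorem pairwise_blockGate {m i o : ℕ} (m1 : 1 ≤ m) (mn : m ≤ n) (_hi : i < 2 * n)
    (_ho : o ≤ 2 * n) (vs : List (Finset (Fin (2 * n))))
    (hv : ∀ m' i' o', 1 ≤ m' → m' ≤ n → i' < 2 * n → o' ≤ 2 * n →
      vs.getD (enc n m' i' o') ∅ ⊆ vbound n m' i' o')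
    {args : List (Operand S (Fin (2 * n)))} (hg : blockGate S n c m i o = .prod args) :
    (args.map (operandVarSet vs)).Pairwise Disjoint := by
  rcases o_cases m o with rfl | rfl | rfl | hbig | ⟨t, t1, htm, rfl⟩ | ⟨s, hs, rfl⟩
  · rw [blockGate_zero] at hg
    cases hg
    rw [List.map_cons, List.map_cons, List.map_nil, List.pairwise_pair]
    exact (Iv_disjoint (show i + 1 ≤ i + 2 * m - 1 by omega)).mono (operandVarSet_xOp S n vs i)
      (operandVarSet_xOp S n vs _)
  · rw [blockGate_one] at hg
    cases hg
  · rw [blockGate_two] at hg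
    cases hg
    rw [List.map_cons, List.map_cons, List.map_nil, List.pairwise_pair]
    have h1 := hv m i 1 m1 mn _hi (by omega)
    rw [vbound, if_pos le_rfl] at h1
    have h2 := operandVarSet_refOp S n vs (t := m - 1) (i := i + 1) (by omega) hv
    refine Disjoint.mono (by simpa [operandVarSet] using h1) h2 ?_
    exact Finset.disjoint_union_left.2
      ⟨Iv_disjoint le_rfl, (Iv_disjoint (show i + 1 + 2 * (m - 1) ≤ i + 2 * m - 1 by omega)).symm⟩
  · rw [blockGate_big S n c m1 hbig] at hg
    cases hg
  · rw [blockGate_odd S n c t1 htm] at hg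
    cases hg
    rw [List.map_cons, List.map_cons, List.map_nil, List.pairwise_pair]
    exact (Iv_disjoint le_rfl).mono (operandVarSet_refOp S n vs (by omega) hv)
      (operandVarSet_refOp S n vs (by omega) hv)
  · rw [blockGate_even S n c hs] at hg
    cases hg

variable {n} in
/-- From the invariant at all gate numbers to the bounds at encoded triples. [folklore] -/
theorem hv_of_inv (vs : List (Finset (Fin (2 * n))))
    (h : ∀ q, vs.getD q ∅ ⊆ vbound n (dM n q) (dI n q) (dO n q)) :
    ∀ m' i' o', 1 ≤ m' → m' ≤ n → i' < 2 * n → o' ≤ 2 * n →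
      vs.getD (enc n m' i' o') ∅ ⊆ vbound n m' i' o' := by
  intro m' i' o' h1 _ h3 h4
  have := h (enc n m' i' o')
  obtain ⟨e1, e2, e3⟩ := dec_enc h1 h3 h4
  rwa [e1, e2, e3] at this

/-- **The invariant**: every prefix of the circuit has syntactic variable sets within the
bounds. [cite: RazYehudayoff2008, §4.1 (eq. (4.1))] -/
theorem gateVarSets_ryCircuit_inv {T : ℕ} (hT : T ≤ n * (2 * n) * (2 * n + 1)) :
    ∀ q, (gateVarSets ((List.range T).map (gateAt S n c))).getD q ∅ ⊆
      vbound n (dM n q) (dI n q) (dO n q) := by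
  apply gateVarSets_range_map_inv (gateAt S n c)
    (fun q s => s ⊆ vbound n (dM n q) (dI n q) (dO n q)) (fun q => Finset.empty_subset _)
  intro p hp vs _ hvs
  obtain ⟨m1, mn, hi, ho, -⟩ := dec_valid (n := n) (p := p) (by omega)
  exact varSet_blockGate S n c m1 mn hi ho vs (hv_of_inv vs hvs)

/-- **The circuit is syntactically multilinear.** [cite: RazYehudayoff2008, §2 and §4.1] -/
theorem isSyntacticallyMultilinear_ryCircuit : IsSyntacticallyMultilinear (ryCircuit S n c) := by
  intro p args hp
  have hpT : p < n * (2 * n) * (2 * n + 1) := by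
    obtain ⟨h, -⟩ := List.getElem?_eq_some_iff.mp hp
    simpa [ryCircuit] using h
  have hg : gateAt S n c p = .prod args := by
    simpa [ryCircuit, List.getElem?_range hpT] using hp
  have htake : (ryCircuit S n c).gates.take p = (List.range p).map (gateAt S n c) := by
    show ((List.range _).map _).take p = _
    rw [← List.map_take, List.take_range, Nat.min_eq_left hpT.le]
  rw [htake]
  obtain ⟨m1, mn, hi, ho, -⟩ := dec_valid hpT
  exact pairwise_blockGate S n c m1 mn hi ho _
    (hv_of_inv _ (gateVarSets_ryCircuit_inv S n c hpT.le)) hg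

end Circuit

/-! ### The vendored polynomial -/

section Vendored

universe u

variable (F : Type u) [Field F] (n : ℕ)

/-- The coefficients `ω_{i,ℓ,j}` as constants of `K = F(W)`. [cite: RazYehudayoff2008, §4.1] [cite: AlonKumarVolk2020, §4.1] -/
def omegaK (i l j : ℕ) : RYField F n :=
  algebraMap (MvPolynomial (RYAux (2 * n)) F) (RYField F n) (wPoly F (2 * n) i l j)

/-- Out of range the `ω`'s vanish. [folklore] -/
theorem omegaK_eq_zero {i : ℕ} (hi : 2 * n ≤ i) (l j : ℕ) : omegaK F n i l j = 0 := by
  unfold omegaK wPoly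
  rw [dif_neg (by omega), map_zero]

/-- The vendored polynomial over `K` is `f_{[0, 2n)}` of the family with `c = ω` and fuel `n`. [cite: RazYehudayoff2008, §4.1] -/
theorem razYehudayoffPolyK_eq_gv :
    razYehudayoffPolyK F n = gv (RYField F n) n (omegaK F n) (2 * n) 0 := by
  show toRYField F n (ryF F (2 * n) (n + 1) (2 * n) 0) = ryFc _ _ _ n (2 * n) 0
  rw [toRYField_ryF]
  exact ryFc_stable _ (by omega) (by omega) 0

end Vendored

end RazYehudayoff

/-! ### The named fact -/

universe u

open RazYehudayoff in
/-- **Raz–Yehudayoff 2008 (§4.1, Thm. 4.4(2)) / Alon–Kumar–Volk 2020 (§4.1), proved**: with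
`C = 6`, for every field `F` and every `n` the Raz–Yehudayoff polynomial over `K = F(W)` has a
fan-in-two syntactically multilinear circuit in the variables `X` alone with at most `C (n³ + 1)`
gates (`RazYehudayoff.ryCircuit`, `4n³ + 2n²` gates). Discharges the named fact
`RazYehudayoff2008_smCircuit`. [cite: RazYehudayoff2008, §4.1 and Thm. 4.4(2)] [cite: AlonKumarVolk2020, §4.1 (closing remark)] -/
theorem RazYehudayoff2008_smCircuit_holds : RazYehudayoff2008_smCircuit.{u} := by
  refine ⟨6, fun F _ n => ?_⟩
  rw [razYehudayoffPolyK_eq_gv]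
  refine (smCircuitSize_le (isFanInTwo_ryCircuit _ n (omegaK F n))
    (isSyntacticallyMultilinear_ryCircuit _ n (omegaK F n))
    (eval_ryCircuit _ (fun i l j hi => omegaK_eq_zero F n hi l j))).trans ?_
  exact_mod_cast size_ryCircuit_le _ n (omegaK F n)

end Literature.Barriers.ValiantsHypothesis
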